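import Mathlib
import Summits.Ventures.PercRepro2.Defs
import Summits.Ventures.PercRepro2.Independence
import Summits.Ventures.PercRepro2.Harris
import Summits.Ventures.PercRepro2.Graph
import Summits.Ventures.PercRepro2.Events
import Summits.Ventures.PercRepro2.BHKEvents
import Summits.Ventures.PercRepro2.RProduct
import Summits.Ventures.PercRepro2.RootCutSupport
import Summits.Ventures.PercRepro2.CutSepDefs
import Summits.Ventures.PercRepro2.CutSamePM

/-!
# The H-half of the weighted (PM) across a cut vertex, same-side placement (blind cell PercRepro2,
mine-2 g20; proofs/MINE2-CUTU.md Theorem 1 + Theorem 4, M2-42)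

Same class as `CutSamePM.lean` (`CutSame`: sides `VL ∋ a₁, o, b` and `VH ∋ a₂` meeting only in the host `u`).
The far side enters only through `B = {u ↔ a₂ in VH}` (Theorem 1, pinning) and the proof of
`LeafRootPMH.halfH_nonneg` goes through verbatim with `β = P(B)`:

  `(1 − t_u) · HALF_H = β · [ (1 − β) t_u x_b ((1 − β) C_ou + β (1 − t_u) x_o) + P(Q)² · D ]`,
  `D = x_b m_o − y'(1 − t_u) ≥ 0` (BHK 1.4 inside `VL`: the clusters of `a₁` and `u` given `a₁ ↮ u`).

**Theorem `halfH_same_nonneg`**: the cleared H-half ≥ 0 on the class.  With `CutSamePM.halfL_same_nonneg`,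
`CutMixedPM.halfL_mixed_nonneg` / `halfH_mixed_nonneg` and the mirrors under `a₁ ↔ a₂`, both per-side
brackets of the weighted (PM) are kernel theorems for EVERY placement of `o, b` whenever the host is an
unmarked cut vertex separating the roots (Theorem 6; the step to `β₁` itself is paper).  Typed: not claimed.
-/

namespace Summit.Ventures.PercRepro2

namespace CutSamePM

open CovForm.RootBridge CutMixedPM

section SetAlgebraH

variable {X : Type*}

/-- Set algebra: `A ∩ (O ∩ A)ᶜ = A ∩ Oᶜ`. -/
lemma set_e2 (O A : Set X) : A ∩ (O ∩ A)ᶜ = A ∩ Oᶜ := by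
  ext ω; simp only [Set.mem_inter_iff, Set.mem_compl_iff]; tauto

/-- Set algebra: `O ∩ Xb ∩ A ∩ (O ∩ A)ᶜ = ∅`. -/
lemma set_e3 (Xb O A : Set X) : O ∩ Xb ∩ A ∩ (O ∩ A)ᶜ = ∅ := by
  ext ω; simp only [Set.mem_inter_iff, Set.mem_compl_iff, Set.mem_empty_iff_false]; tauto

/-- Set algebra: `O ∩ Xb ∩ Lo ∩ (O ∩ A)ᶜ = (Lo ∩ Xb ∩ Aᶜ) ∩ O`. -/
lemma set_e5 (Xb Lo O A : Set X) : O ∩ Xb ∩ Lo ∩ (O ∩ A)ᶜ = (Lo ∩ Xb ∩ Aᶜ) ∩ O := by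
  ext ω; simp only [Set.mem_inter_iff, Set.mem_compl_iff]; tauto

/-- Set algebra: `A ∩ (Lo ∪ O ∩ Xo) ∩ (O ∩ A)ᶜ = (Lo ∩ A) ∩ Oᶜ`. -/
lemma set_e7 (Lo Xo O A : Set X) : A ∩ (Lo ∪ O ∩ Xo) ∩ (O ∩ A)ᶜ = (Lo ∩ A) ∩ Oᶜ := by
  ext ω; simp only [Set.mem_inter_iff, Set.mem_compl_iff, Set.mem_union]; tauto

/-- Set algebra: `O ∩ Xb ∩ A ∩ (Lo ∪ O ∩ Xo) ∩ (O ∩ A)ᶜ = ∅`. -/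
lemma set_e8 (Xb Lo Xo O A : Set X) : O ∩ Xb ∩ A ∩ (Lo ∪ O ∩ Xo) ∩ (O ∩ A)ᶜ = ∅ := by
  ext ω; simp only [Set.mem_inter_iff, Set.mem_compl_iff, Set.mem_union, Set.mem_empty_iff_false]
  tauto

end SetAlgebraH

section MainH

variable {V : Type*} {E : Type*} [Fintype E] [DecidableEq E] [Fintype V] [DecidableEq V]
  {R : Type*} [CommRing R] [LinearOrder R] [IsStrictOrderedRing R]

/-- **The H-half of the weighted (PM) is nonnegative when the host `u` is a cut vertex separating the
roots with `o, b` on `a₁`'s side** (proofs/MINE2-CUTU.md Theorems 1 + 4): with `Q = {a₁ ↮ a₂}`,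
`H_b = {a₂ ↔ b}`, `L_u = {a₁ ↔ u}`,
`L_o = {a₁ ↔ o}`, `oU = {a₁ ↔ o} ∪ {a₂ ↔ o}`,
`0 ≤ P(Q)·[P(Q) P(H_b L_u oU Q) − P(H_b Q) P(L_u oU Q)] − P(oU Q)·[P(Q) P(H_b L_u Q) − P(H_b Q) P(L_u Q)]
      − P(Q)·[P(Q) P(H_b L_o Q) − P(H_b Q) P(L_o Q)]`. -/
theorem halfH_same_nonneg (p : E → R) (hp : IsProbVec p) (ends : E → Sym2 V) (o a₁ a₂ b u : V)
    {VL VH : Set V} (hc : CutSame ends a₁ o b a₂ u VL VH) :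
    0 ≤ prob p (connEvent ends a₁ a₂)ᶜ *
          (prob p (connEvent ends a₁ a₂)ᶜ *
              prob p (connEvent ends a₂ b ∩ connEvent ends a₁ u ∩
                (connEvent ends a₁ o ∪ connEvent ends a₂ o) ∩ (connEvent ends a₁ a₂)ᶜ) -
            prob p (connEvent ends a₂ b ∩ (connEvent ends a₁ a₂)ᶜ) *
              prob p (connEvent ends a₁ u ∩ (connEvent ends a₁ o ∪ connEvent ends a₂ o) ∩
                (connEvent ends a₁ a₂)ᶜ)) -
        prob p ((connEvent ends a₁ o ∪ connEvent ends a₂ o) ∩ (connEvent ends a₁ a₂)ᶜ) *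
          (prob p (connEvent ends a₁ a₂)ᶜ *
              prob p (connEvent ends a₂ b ∩ connEvent ends a₁ u ∩ (connEvent ends a₁ a₂)ᶜ) -
            prob p (connEvent ends a₂ b ∩ (connEvent ends a₁ a₂)ᶜ) *
              prob p (connEvent ends a₁ u ∩ (connEvent ends a₁ a₂)ᶜ)) -
        prob p (connEvent ends a₁ a₂)ᶜ *
          (prob p (connEvent ends a₁ a₂)ᶜ *
              prob p (connEvent ends a₂ b ∩ connEvent ends a₁ o ∩ (connEvent ends a₁ a₂)ᶜ) -
            prob p (connEvent ends a₂ b ∩ (connEvent ends a₁ a₂)ᶜ) *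
              prob p (connEvent ends a₁ o ∩ (connEvent ends a₁ a₂)ᶜ)) := by
  have hQ : connEvent ends a₁ a₂ = CW ends VH u a₂ ∩ CW ends VL a₁ u := by
    rw [connEvent_eq_cross_LH hc hc.a1L hc.a2H hc.a2u, Set.inter_comm]
  have hHb : connEvent ends a₂ b = CW ends VH u a₂ ∩ CW ends VL u b := by
    rw [connEvent_eq_cross_HL hc hc.a2H hc.bL hc.bu, CW_comm (ends := ends) a₂ u]
  have hHo : connEvent ends a₂ o = CW ends VH u a₂ ∩ CW ends VL u o := by
    rw [connEvent_eq_cross_HL hc hc.a2H hc.oL hc.ou, CW_comm (ends := ends) a₂ u]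
  have hLo : connEvent ends a₁ o = CW ends VL a₁ o := connEvent_eq_CW_L hc hc.a1L hc.oL
  have hA' : connEvent ends a₁ u = CW ends VL a₁ u := connEvent_eq_CW_L hc hc.a1L hc.uL
  have hXb' : connEvent ends u b = CW ends VL u b := connEvent_eq_CW_L hc hc.uL hc.bL
  rw [hQ, hHb, hHo, hLo, hA']
  set A := CW ends VL a₁ u with hA
  set O := CW ends VH u a₂ with hO
  set Xb := CW ends VL u b with hXb
  set Lo := CW ends VL a₁ o with hLo'
  set Xo := CW ends VL u o with hXo
  have hdis := disjoint_within hc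
  have dA : DependsOn (· ∈ A) (within ends VL) := dependsOn_CW a₁ u
  have dXb : DependsOn (· ∈ Xb) (within ends VL) := dependsOn_CW u b
  have dLo : DependsOn (· ∈ Lo) (within ends VL) := dependsOn_CW a₁ o
  have dXo : DependsOn (· ∈ Xo) (within ends VL) := dependsOn_CW u o
  have dO : DependsOn (· ∈ O) (within ends VH) := dependsOn_CW u a₂
  have dOc : DependsOn (· ∈ Oᶜ) (within ends VH) := dependsOn_compl dO
  have dAc : DependsOn (· ∈ Aᶜ) (within ends VL) := dependsOn_compl dA
  have prob_inter_openEdge_of_dependsOn : ∀ {X : Set (Config E)}, DependsOn (· ∈ X) (within ends VL) →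
      prob p (X ∩ O) = prob p X * prob p O :=
    fun hX => prob_inter_eq_mul_of_dependsOn p hdis hX dO
  have prob_inter_compl_openEdge_of_dependsOn : ∀ {X : Set (Config E)}, DependsOn (· ∈ X) (within ends VL) →
      prob p (X ∩ Oᶜ) = prob p X * (1 - prob p O) := by
    intro X hX
    rw [prob_inter_eq_mul_of_dependsOn p hdis hX dOc, prob_compl]
  have hLoXo : Lo ∩ Xo ⊆ A := CW_inter_subset a₁ o u
  have hdisj1 : Disjoint (Lo ∩ (O ∩ A)ᶜ) ((Xo ∩ Aᶜ) ∩ O) := by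
    rw [Set.disjoint_left]
    rintro ω ⟨hLo', hc⟩ ⟨⟨hXo', hA'⟩, hO'⟩
    exact hA' (hLoXo ⟨hLo', hXo'⟩)
  have hβ0 : 0 ≤ prob p O := prob_nonneg hp O
  have hβ1 : prob p O ≤ 1 := prob_le_one hp O
  have htu1 : prob p A ≤ 1 := prob_le_one hp A
  have hAc : prob p Aᶜ = 1 - prob p A := prob_compl p A
  have hsplit_o : prob p (Lo ∩ A) + prob p (Lo ∩ Aᶜ) = prob p Lo :=
    prob_inter_add_prob_inter_compl p Lo A
  -- dictionary
  have d0 : prob p (O ∩ A)ᶜ = 1 - prob p A * prob p O := by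
    rw [prob_compl, Set.inter_comm, prob_inter_openEdge_of_dependsOn dA]
  have e1 : prob p (O ∩ Xb ∩ (O ∩ A)ᶜ) = prob p (Xb ∩ Aᶜ) * prob p O := by
    rw [set_d4, prob_inter_openEdge_of_dependsOn (depI dXb dAc)]
  have e2 : prob p (A ∩ (O ∩ A)ᶜ) = prob p A * (1 - prob p O) := by
    rw [set_e2, prob_inter_compl_openEdge_of_dependsOn dA]
  have e3 : prob p (O ∩ Xb ∩ A ∩ (O ∩ A)ᶜ) = 0 := by
    rw [set_e3, prob_empty]
  have e4 : prob p (Lo ∩ (O ∩ A)ᶜ) = prob p Lo - prob p (Lo ∩ A) * prob p O := by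
    have := prob_inter_add_prob_inter_compl p Lo (O ∩ A)
    rw [set_d1, prob_inter_openEdge_of_dependsOn (depI dLo dA)] at this
    linarith
  have e5 : prob p (O ∩ Xb ∩ Lo ∩ (O ∩ A)ᶜ) = prob p (Lo ∩ Xb ∩ Aᶜ) * prob p O := by
    rw [set_e5, prob_inter_openEdge_of_dependsOn (depI (depI dLo dXb) dAc)]
  have e6 : prob p ((Lo ∪ O ∩ Xo) ∩ (O ∩ A)ᶜ) =
      (prob p Lo - prob p (Lo ∩ A) * prob p O) + prob p (Xo ∩ Aᶜ) * prob p O := by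
    rw [set_d6, prob_union_of_disjoint p hdisj1, e4,
      prob_inter_openEdge_of_dependsOn (depI dXo dAc)]
  have e7 : prob p (A ∩ (Lo ∪ O ∩ Xo) ∩ (O ∩ A)ᶜ) = prob p (Lo ∩ A) * (1 - prob p O) := by
    rw [set_e7, prob_inter_compl_openEdge_of_dependsOn (depI dLo dA)]
  have e8 : prob p (O ∩ Xb ∩ A ∩ (Lo ∪ O ∩ Xo) ∩ (O ∩ A)ᶜ) = 0 := by
    rw [set_e8, prob_empty]
  rw [d0, e1, e2, e3, e4, e5, e6, e7, e8]
  clear d0 e1 e2 e3 e4 e5 e6 e7 e8 hdisj1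
  -- BHK 1.4 (cross-cluster given `a₁ ↮ u`) and Harris
  have hBHK := bhk_cross_cluster p hp ends a₁ u (𝓤 := {W : Set V | o ∈ W})
    (𝓥 := {W : Set V | b ∈ W}) (fun _ _ h hW => h hW) (fun _ _ h hW => h hW)
  rw [RProduct.clusterInEvent_mem_eq, RProduct.clusterInEvent_mem_eq, hLo, hXb', hA'] at hBHK
  have hHarris_o := prob_mul_prob_le_prob_inter hp (isUpperSet_CW (ends := ends) (W := VL) a₁ o)
    (isUpperSet_CW (ends := ends) (W := VL) a₁ u)
  have hxo := prob_nonneg hp (Xo ∩ Aᶜ)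
  have hxb := prob_nonneg hp (Xb ∩ Aᶜ)
  have hmo := prob_nonneg hp (Lo ∩ Aᶜ)
  have hyp := prob_nonneg hp (Lo ∩ Xb ∩ Aᶜ)
  have hkou := prob_nonneg hp (Lo ∩ A)
  have htu0 := prob_nonneg hp A
  have hxb_le : prob p (Xb ∩ Aᶜ) ≤ prob p Aᶜ := prob_mono hp Set.inter_subset_right
  have hmo_le : prob p (Lo ∩ Aᶜ) ≤ prob p Aᶜ := prob_mono hp Set.inter_subset_right
  have hxo_le : prob p (Xo ∩ Aᶜ) ≤ prob p Aᶜ := prob_mono hp Set.inter_subset_right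
  have hyp_le : prob p (Lo ∩ Xb ∩ Aᶜ) ≤ prob p Aᶜ := prob_mono hp Set.inter_subset_right
  rw [← hsplit_o]
  rw [← hsplit_o] at hHarris_o
  clear hsplit_o dA dXb dLo dXo dAc dO dOc hLoXo prob_inter_openEdge_of_dependsOn prob_inter_compl_openEdge_of_dependsOn
  generalize hβ : prob p O = β at *
  generalize htu : prob p A = tu at *
  generalize hac : prob p Aᶜ = ac at *
  generalize hkou' : prob p (Lo ∩ A) = kou at *
  generalize hmo' : prob p (Lo ∩ Aᶜ) = mo at *
  generalize hxo' : prob p (Xo ∩ Aᶜ) = xo at *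
  generalize hxb' : prob p (Xb ∩ Aᶜ) = xb at *
  generalize hyp' : prob p (Lo ∩ Xb ∩ Aᶜ) = yp at *
  clear hβ htu hac hkou' hmo' hxo' hxb' hyp' hQ hHb hHo hLo hA' hXb' hc hdis
  subst hAc
  have hD : 0 ≤ xb * mo - yp * (1 - tu) := by linarith only [hBHK]
  have hCo : 0 ≤ kou - tu * (kou + mo) := by linarith only [hHarris_o]
  have key : (1 - tu) *
      ((1 - tu * β) * ((1 - tu * β) * 0 - xb * β * (kou * (1 - β))) -
        (kou + mo - kou * β + xo * β) * ((1 - tu * β) * 0 - xb * β * (tu * (1 - β))) -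
        (1 - tu * β) * ((1 - tu * β) * (yp * β) - xb * β * (kou + mo - kou * β))) =
      β * ((1 - β) * tu * xb * ((1 - β) * (kou - tu * (kou + mo)) + β * (1 - tu) * xo) +
        (1 - tu * β) * (1 - tu * β) * (xb * mo - yp * (1 - tu))) := by
    ring
  have h1β : 0 ≤ 1 - β := by linarith only [hβ1]
  have h1tu : 0 ≤ 1 - tu := by linarith only [htu1]
  have hRHS : 0 ≤ β * ((1 - β) * tu * xb * ((1 - β) * (kou - tu * (kou + mo)) + β * (1 - tu) * xo) +
        (1 - tu * β) * (1 - tu * β) * (xb * mo - yp * (1 - tu))) := by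
    apply mul_nonneg hβ0
    apply add_nonneg
    · apply mul_nonneg (mul_nonneg (mul_nonneg h1β htu0) hxb)
      exact add_nonneg (mul_nonneg h1β hCo) (mul_nonneg (mul_nonneg hβ0 h1tu) hxo)
    · exact mul_nonneg (mul_self_nonneg _) hD
  rcases eq_or_lt_of_le h1tu with h | h
  · have z1 : xb = 0 := le_antisymm (by linarith only [hxb_le, h]) hxb
    have z2 : mo = 0 := le_antisymm (by linarith only [hmo_le, h]) hmo
    have z3 : xo = 0 := le_antisymm (by linarith only [hxo_le, h]) hxo
    have z4 : yp = 0 := le_antisymm (by linarith only [hyp_le, h]) hyp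
    have htu' : tu = 1 := by linarith only [h]
    rw [z1, z2, z3, z4, htu']
    ring_nf
    exact le_refl _
  · exact (mul_nonneg_iff_of_pos_left h).mp (key ▸ hRHS)

end MainH

end CutSamePM

end Summit.Ventures.PercRepro2
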